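import Mathlib
import HarnessLib
import Summits.Ventures.LatticeQCDFlow.Scoring.SU3HaarWeylDischarge
import Literature.MathematicalPhysics.QuantumFieldTheory.WilsonPlaquetteWeakCouplingFloor

/-!
# LatticeQCDFlow / Scaling — an explicit UPPER bound for the Haar probability of small balls in `SU(3)`:
# `Haar{3 − Re tr U ≤ η} ≤ (256/3)·η³` and `Haar{‖U − 1‖_F ≤ r} ≤ (32/3)·r⁶`

HONEST FRAMING: exact (Metropolis-corrected) sampling algorithms for lattice gauge theory;
figures of merit are autocorrelation/cost numbers at stated couplings and volumes; no
continuum-physics claim.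

Venture `LatticeQCDFlow` (cell pub-lqcd), topic `Scaling`, FANOUT row 30 (lean-1, GEN-21) — OUR WORK: the
companion of `Scaling/SU3HaarSmallBall` (`Haar{‖U − 1‖_F ≤ r} ≥ r⁸/(64000π⁸)`), the `SU(3)` input that the
logarithmic loss floor of `Scaling/AutoregressiveGaugeStepKLLogFloor` needs from ABOVE (`log(1/φ_ρ(ε))`).
Tool: the tree's Weyl integral formula for `SU(3)` (`Scoring/SU3HaarWeylDischarge`), a continuous majorant
of the indicator, and the pointwise bound `|Δ|² ≤ 64·(3 − Re tr)³` on the maximal torus — each Vandermonde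
factor `2 − 2cos(θ_i − θ_j)` is `≤ 4((1 − cos θ_i) + (1 − cos θ_j))` by the half-angle formula, and
`Σ_i (1 − cos θ_i) = 3 − Re tr`.  The order `η³` (`r⁶`) is one power short of the truth (`η⁴ ≍ r⁸ = r^{dim}`,
which would need the area of the torus neighbourhood as well); any polynomial order suffices downstream.

## What is proved (all [ours])

* §1 `one_sub_cos_sub_le` (`1 − cos(a − b) ≤ 2(1 − cos a) + 2(1 − cos b)`),
  **`weylSU3_le_mul_cube`** (`|Δ|²(θ) ≤ 64·(3 − reTrSU3 θ)³`).
* §2 `intervalIntegral_le_mul_of_le` (a one-variable ceiling), `torusIntegral_majorant_le`,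
  `haar_real_le_integral_majorant`; **`haar_su3_three_sub_trace_le_le`** —
  `Haar{U ∈ SU(3) : 3 − Re tr U ≤ η} ≤ (256/3)·η³` for `0 < η`.
* §3 **`haarProbability_real_ball_le_su3`** — `Haar{‖fundamentalRep (Fin 3) U − 1‖_F ≤ r} ≤ (32/3)·r⁶`
  for `0 < r`.

No `def`, no `sorry`, nothing cited as a fact beyond the tree.
-/

noncomputable section

namespace Summit.Ventures.LatticeQCDFlow.Theory2.WeakCoupling

open MeasureTheory Real intervalIntegral Set
open Summit.Ventures.LatticeQCDFlow.Scoring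
open Literature.MathematicalPhysics.QuantumFieldTheory Literature.MathematicalPhysics.QuantumLattice
open scoped Matrix Matrix.Norms.Frobenius

/-! ## §1 The Weyl density is controlled by the trace deficit -/

/-- `1 − cos(a − b) ≤ 2(1 − cos a) + 2(1 − cos b)` (half angles: `sin((a−b)/2) = sin(a/2)cos(b/2) −
cos(a/2)sin(b/2)`). [folklore] -/
theorem one_sub_cos_sub_le (a b : ℝ) :
    1 - Real.cos (a - b) ≤ 2 * (1 - Real.cos a) + 2 * (1 - Real.cos b) := by
  have ha : 1 - Real.cos a = 2 * Real.sin (a / 2) ^ 2 := by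
    have h2 : Real.cos a = Real.cos (2 * (a / 2)) := by ring_nf
    rw [h2, Real.cos_two_mul]
    nlinarith [Real.sin_sq_add_cos_sq (a / 2)]
  have hb : 1 - Real.cos b = 2 * Real.sin (b / 2) ^ 2 := by
    have h2 : Real.cos b = Real.cos (2 * (b / 2)) := by ring_nf
    rw [h2, Real.cos_two_mul]
    nlinarith [Real.sin_sq_add_cos_sq (b / 2)]
  have hab : 1 - Real.cos (a - b) = 2 * Real.sin ((a - b) / 2) ^ 2 := by
    have h2 : Real.cos (a - b) = Real.cos (2 * ((a - b) / 2)) := by ring_nf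
    rw [h2, Real.cos_two_mul]
    nlinarith [Real.sin_sq_add_cos_sq ((a - b) / 2)]
  have hsin : Real.sin ((a - b) / 2) =
      Real.sin (a / 2) * Real.cos (b / 2) - Real.cos (a / 2) * Real.sin (b / 2) := by
    rw [show (a - b) / 2 = a / 2 - b / 2 by ring, Real.sin_sub]
  rw [ha, hb, hab, hsin]
  have hc1 : Real.cos (b / 2) ^ 2 ≤ 1 := Real.cos_sq_le_one _
  have hc2 : Real.cos (a / 2) ^ 2 ≤ 1 := Real.cos_sq_le_one _
  nlinarith [sq_nonneg (Real.sin (a / 2) * Real.cos (b / 2) + Real.cos (a / 2) * Real.sin (b / 2)),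
    mul_nonneg (sq_nonneg (Real.sin (a / 2))) (sub_nonneg.2 hc1),
    mul_nonneg (sq_nonneg (Real.sin (b / 2))) (sub_nonneg.2 hc2)]

/-- **`|Δ|² ≤ 64·(3 − Re tr)³` on the maximal torus of `SU(3)`.** [ours] -/
theorem weylSU3_le_mul_cube (θ₁ θ₂ : ℝ) :
    weylSU3 θ₁ θ₂ ≤ 64 * (3 - reTrSU3 θ₁ θ₂) ^ 3 := by
  unfold weylSU3 reTrSU3
  set c₁ : ℝ := 1 - Real.cos θ₁ with hc₁
  set c₂ : ℝ := 1 - Real.cos θ₂ with hc₂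
  set c₃ : ℝ := 1 - Real.cos (θ₁ + θ₂) with hc₃
  have h0₁ : 0 ≤ c₁ := by rw [hc₁]; linarith [Real.cos_le_one θ₁]
  have h0₂ : 0 ≤ c₂ := by rw [hc₂]; linarith [Real.cos_le_one θ₂]
  have h0₃ : 0 ≤ c₃ := by rw [hc₃]; linarith [Real.cos_le_one (θ₁ + θ₂)]
  set S : ℝ := c₁ + c₂ + c₃ with hS
  have eS : 3 - (Real.cos θ₁ + Real.cos θ₂ + Real.cos (θ₁ + θ₂)) = S := by
    simp only [hS, hc₁, hc₂, hc₃]; ring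
  rw [eS]
  -- the three factors
  have f1 : 2 - 2 * Real.cos (θ₁ - θ₂) ≤ 4 * S := by
    have h := one_sub_cos_sub_le θ₁ θ₂
    simp only [hS, hc₁, hc₂]
    linarith
  have f2 : 2 - 2 * Real.cos (2 * θ₁ + θ₂) ≤ 4 * S := by
    have h := one_sub_cos_sub_le θ₁ (-(θ₁ + θ₂))
    rw [show θ₁ - -(θ₁ + θ₂) = 2 * θ₁ + θ₂ by ring, Real.cos_neg] at h
    simp only [hS, hc₁, hc₃]
    linarith
  have f3 : 2 - 2 * Real.cos (θ₁ + 2 * θ₂) ≤ 4 * S := by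
    have h := one_sub_cos_sub_le θ₂ (-(θ₁ + θ₂))
    rw [show θ₂ - -(θ₁ + θ₂) = θ₁ + 2 * θ₂ by ring, Real.cos_neg] at h
    simp only [hS, hc₂, hc₃]
    linarith
  have n1 : 0 ≤ 2 - 2 * Real.cos (θ₁ - θ₂) := by linarith [Real.cos_le_one (θ₁ - θ₂)]
  have n2 : 0 ≤ 2 - 2 * Real.cos (2 * θ₁ + θ₂) := by linarith [Real.cos_le_one (2 * θ₁ + θ₂)]
  have n3 : 0 ≤ 2 - 2 * Real.cos (θ₁ + 2 * θ₂) := by linarith [Real.cos_le_one (θ₁ + 2 * θ₂)]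
  calc (2 - 2 * Real.cos (θ₁ - θ₂)) * (2 - 2 * Real.cos (2 * θ₁ + θ₂)) * (2 - 2 * Real.cos (θ₁ + 2 * θ₂))
      ≤ (4 * S) * (4 * S) * (4 * S) :=
        mul_le_mul (mul_le_mul f1 f2 n2 (n1.trans f1)) f3 n3 (mul_nonneg (n1.trans f1) (n2.trans f2))
    _ = 64 * S ^ 3 := by ring

/-! ## §2 The small-ball bound in the trace variable, from above -/

/-- `∫_a^b f ≤ c·(b − a)` for a continuous `f ≤ c` on `[a, b]`, `a ≤ b`. [folklore] -/
theorem intervalIntegral_le_mul_of_le {f : ℝ → ℝ} {a b c : ℝ} (hf : Continuous f) (hab : a ≤ b)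
    (hc : ∀ x ∈ Icc a b, f x ≤ c) : ∫ x in a..b, f x ≤ c * (b - a) := by
  have hci : IntervalIntegrable (fun _ : ℝ => c) volume a b := continuous_const.intervalIntegrable a b
  have hm := intervalIntegral.integral_mono_on hab (hf.intervalIntegrable a b) hci hc
  rw [intervalIntegral.integral_const, smul_eq_mul] at hm
  linarith

/-- The torus side: for `0 < η`, with the majorant `g_η(t) = min 1 (max 0 ((t − (3 − 2η))/η))`,
`(1/(24π²))∫₀^{2π}∫₀^{2π} g_η(reTrSU3)·|Δ|² ≤ (256/3)·η³`. [ours] -/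
theorem torusIntegral_majorant_le {η : ℝ} (hη0 : 0 < η) :
    1 / (6 * (2 * π) ^ 2) * ∫ θ₁ in (0 : ℝ)..2 * π, ∫ θ₂ in (0 : ℝ)..2 * π,
      min 1 (max 0 ((reTrSU3 θ₁ θ₂ - (3 - 2 * η)) / η)) * weylSU3 θ₁ θ₂ ≤ 256 / 3 * η ^ 3 := by
  have hπ := Real.pi_pos
  have hg0 : ∀ t : ℝ, 0 ≤ min 1 (max 0 ((t - (3 - 2 * η)) / η)) :=
    fun t => le_min zero_le_one (le_max_left _ _)
  have hg1 : ∀ t : ℝ, min 1 (max 0 ((t - (3 - 2 * η)) / η)) ≤ 1 := fun t => min_le_left _ _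
  have hgzero : ∀ t : ℝ, t ≤ 3 - 2 * η → min 1 (max 0 ((t - (3 - 2 * η)) / η)) = 0 := by
    intro t ht
    have hneg : (t - (3 - 2 * η)) / η ≤ 0 := div_nonpos_of_nonpos_of_nonneg (by linarith) hη0.le
    rw [max_eq_left hneg, min_eq_right zero_le_one]
  -- pointwise: the integrand is at most `512 η³`
  have hpt : ∀ θ₁ θ₂ : ℝ,
      min 1 (max 0 ((reTrSU3 θ₁ θ₂ - (3 - 2 * η)) / η)) * weylSU3 θ₁ θ₂ ≤ 512 * η ^ 3 := by
    intro θ₁ θ₂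
    by_cases h : reTrSU3 θ₁ θ₂ ≤ 3 - 2 * η
    · rw [hgzero _ h, zero_mul]; positivity
    · rw [not_le] at h
      have hS : 3 - reTrSU3 θ₁ θ₂ ≤ 2 * η := by linarith
      have hS0 : 0 ≤ 3 - reTrSU3 θ₁ θ₂ := by
        have := weylSU3_nonneg θ₁ θ₂
        have hw := weylSU3_le_mul_cube θ₁ θ₂
        by_contra hneg
        rw [not_le] at hneg
        have : (3 - reTrSU3 θ₁ θ₂) ^ 3 < 0 := by
          have := Odd.pow_neg (n := 3) (by decide) hneg
          simpa using this
        linarith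
      have hw : weylSU3 θ₁ θ₂ ≤ 64 * (2 * η) ^ 3 :=
        (weylSU3_le_mul_cube θ₁ θ₂).trans (by gcongr)
      calc min 1 (max 0 ((reTrSU3 θ₁ θ₂ - (3 - 2 * η)) / η)) * weylSU3 θ₁ θ₂
          ≤ 1 * (64 * (2 * η) ^ 3) := mul_le_mul (hg1 _) hw (weylSU3_nonneg _ _) zero_le_one
        _ = 512 * η ^ 3 := by ring
  have hgc : Continuous fun t : ℝ => min 1 (max 0 ((t - (3 - 2 * η)) / η)) :=
    continuous_const.min (continuous_const.max ((continuous_id.sub continuous_const).div_const _))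
  have hhc : Continuous fun p : ℝ × ℝ =>
      (fun θ₁ θ₂ : ℝ => min 1 (max 0 ((reTrSU3 θ₁ θ₂ - (3 - 2 * η)) / η)) * weylSU3 θ₁ θ₂) p.1 p.2 :=
    (hgc.comp (continuous_reTrSU3_comp continuous_fst continuous_snd)).mul
      (continuous_weylSU3_comp continuous_fst continuous_snd)
  -- inner ceiling
  have hinner : ∀ θ₁ ∈ Icc (0 : ℝ) (2 * π),
      ∫ θ₂ in (0 : ℝ)..2 * π, min 1 (max 0 ((reTrSU3 θ₁ θ₂ - (3 - 2 * η)) / η)) * weylSU3 θ₁ θ₂ ≤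
        512 * η ^ 3 * (2 * π - 0) := by
    intro θ₁ _
    have hc1 : Continuous fun θ₂ : ℝ =>
        min 1 (max 0 ((reTrSU3 θ₁ θ₂ - (3 - 2 * η)) / η)) * weylSU3 θ₁ θ₂ :=
      (hgc.comp (continuous_reTrSU3_comp continuous_const continuous_id)).mul
        (continuous_weylSU3_comp continuous_const continuous_id)
    exact intervalIntegral_le_mul_of_le hc1 (by positivity) (fun θ₂ _ => hpt θ₁ θ₂)
  -- outer ceiling
  have hφc : Continuous fun θ₁ : ℝ => ∫ θ₂ in (0 : ℝ)..2 * π,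
      min 1 (max 0 ((reTrSU3 θ₁ θ₂ - (3 - 2 * η)) / η)) * weylSU3 θ₁ θ₂ :=
    continuous_inner_integral
      (g := fun θ₁ θ₂ : ℝ => min 1 (max 0 ((reTrSU3 θ₁ θ₂ - (3 - 2 * η)) / η)) * weylSU3 θ₁ θ₂)
      hhc 0 (2 * π)
  have houter : ∫ θ₁ in (0 : ℝ)..2 * π, ∫ θ₂ in (0 : ℝ)..2 * π,
      min 1 (max 0 ((reTrSU3 θ₁ θ₂ - (3 - 2 * η)) / η)) * weylSU3 θ₁ θ₂ ≤
        512 * η ^ 3 * (2 * π - 0) * (2 * π - 0) :=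
    intervalIntegral_le_mul_of_le hφc (by positivity) hinner
  calc 1 / (6 * (2 * π) ^ 2) * ∫ θ₁ in (0 : ℝ)..2 * π, ∫ θ₂ in (0 : ℝ)..2 * π,
        min 1 (max 0 ((reTrSU3 θ₁ θ₂ - (3 - 2 * η)) / η)) * weylSU3 θ₁ θ₂
      ≤ 1 / (6 * (2 * π) ^ 2) * (512 * η ^ 3 * (2 * π - 0) * (2 * π - 0)) :=
        mul_le_mul_of_nonneg_left houter (by positivity)
    _ = 256 / 3 * η ^ 3 := by field_simp; ring

/-- The group side: `Haar{3 − Re tr U ≤ η} ≤ ∫ g_η(Re tr U) dHaar` (`g_η ≥` the indicator). [ours] -/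
theorem haar_real_le_integral_majorant {η : ℝ} (hη0 : 0 < η) :
    (haarProbability (Matrix.specialUnitaryGroup (Fin 3) ℂ)).real
        {U : Matrix.specialUnitaryGroup (Fin 3) ℂ | 3 - ((U : Matrix (Fin 3) (Fin 3) ℂ).trace).re ≤ η} ≤
      ∫ U, min 1 (max 0 ((((U : Matrix (Fin 3) (Fin 3) ℂ).trace).re - (3 - 2 * η)) / η))
        ∂(haarProbability (Matrix.specialUnitaryGroup (Fin 3) ℂ)) := by
  have hg0 : ∀ t : ℝ, 0 ≤ min 1 (max 0 ((t - (3 - 2 * η)) / η)) :=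
    fun t => le_min zero_le_one (le_max_left _ _)
  have hg1 : ∀ t : ℝ, min 1 (max 0 ((t - (3 - 2 * η)) / η)) ≤ 1 := fun t => min_le_left _ _
  have hgone : ∀ t : ℝ, 3 - η ≤ t → min 1 (max 0 ((t - (3 - 2 * η)) / η)) = 1 := by
    intro t ht
    apply min_eq_left
    refine le_trans ?_ (le_max_right _ _)
    rw [le_div_iff₀ hη0]
    linarith
  have hretr : Continuous fun U : Matrix.specialUnitaryGroup (Fin 3) ℂ =>
      ((U : Matrix (Fin 3) (Fin 3) ℂ).trace).re :=
    Complex.continuous_re.comp ((continuous_id.matrix_trace).comp continuous_subtype_val)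
  have hgc : Continuous fun t : ℝ => min 1 (max 0 ((t - (3 - 2 * η)) / η)) :=
    continuous_const.min (continuous_const.max ((continuous_id.sub continuous_const).div_const _))
  have hSm : MeasurableSet
      {U : Matrix.specialUnitaryGroup (Fin 3) ℂ | 3 - ((U : Matrix (Fin 3) (Fin 3) ℂ).trace).re ≤ η} :=
    measurableSet_le (continuous_const.sub hretr).measurable measurable_const
  rw [← integral_indicator_one hSm]
  have hint : Integrable (fun U : Matrix.specialUnitaryGroup (Fin 3) ℂ =>
      min 1 (max 0 ((((U : Matrix (Fin 3) (Fin 3) ℂ).trace).re - (3 - 2 * η)) / η)))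
      (haarProbability (Matrix.specialUnitaryGroup (Fin 3) ℂ)) :=
    Integrable.mono' (integrable_const (1 : ℝ)) ((hgc.comp hretr).measurable.aestronglyMeasurable)
      (ae_of_all _ fun U => by rw [Real.norm_eq_abs, abs_of_nonneg (hg0 _)]; exact hg1 _)
  refine integral_mono_of_nonneg (ae_of_all _ fun U => ?_) hint (ae_of_all _ fun U => ?_)
  · by_cases hU : U ∈ {U : Matrix.specialUnitaryGroup (Fin 3) ℂ |
        3 - ((U : Matrix (Fin 3) (Fin 3) ℂ).trace).re ≤ η}
    · rw [Set.indicator_of_mem hU]; exact zero_le_one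
    · rw [Set.indicator_of_notMem hU]; exact le_rfl
  · by_cases hU : U ∈ {U : Matrix.specialUnitaryGroup (Fin 3) ℂ |
        3 - ((U : Matrix (Fin 3) (Fin 3) ℂ).trace).re ≤ η}
    · rw [Set.indicator_of_mem hU]
      have hge : 3 - η ≤ ((U : Matrix (Fin 3) (Fin 3) ℂ).trace).re := by
        have : (3 : ℝ) - ((U : Matrix (Fin 3) (Fin 3) ℂ).trace).re ≤ η := hU
        linarith
      show (1 : ℝ) ≤ min 1 (max 0 ((((U : Matrix (Fin 3) (Fin 3) ℂ).trace).re - (3 - 2 * η)) / η))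
      rw [hgone _ hge]
    · rw [Set.indicator_of_notMem hU]; exact hg0 _

/-- **`Haar{U ∈ SU(3) : 3 − Re tr U ≤ η} ≤ (256/3)·η³`** for `0 < η`. [ours] -/
theorem haar_su3_three_sub_trace_le_le {η : ℝ} (hη0 : 0 < η) :
    (haarProbability (Matrix.specialUnitaryGroup (Fin 3) ℂ)).real
        {U : Matrix.specialUnitaryGroup (Fin 3) ℂ | 3 - ((U : Matrix (Fin 3) (Fin 3) ℂ).trace).re ≤ η} ≤
      256 / 3 * η ^ 3 := by
  have hgc : Continuous fun t : ℝ => min 1 (max 0 ((t - (3 - 2 * η)) / η)) :=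
    continuous_const.min (continuous_const.max ((continuous_id.sub continuous_const).div_const _))
  have hweyl := SU3Haar.integral_haar_su3_traceFun_eq_integral2
    (fun t : ℝ => min 1 (max 0 ((t - (3 - 2 * η)) / η))) hgc
  beta_reduce at hweyl
  exact (haar_real_le_integral_majorant hη0).trans (hweyl ▸ torusIntegral_majorant_le hη0)

/-! ## §3 The Frobenius-ball form -/

/-- **`Haar{U ∈ SU(3) : ‖U − 1‖_F ≤ r} ≤ (32/3)·r⁶`** for `0 < r` (`‖U − 1‖_F² = 2(3 − Re tr U)`). [ours] -/
theorem haarProbability_real_ball_le_su3 {r : ℝ} (hr : 0 < r) :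
    (haarProbability (Matrix.specialUnitaryGroup (Fin 3) ℂ)).real
        {U : Matrix.specialUnitaryGroup (Fin 3) ℂ | ‖fundamentalRep (Fin 3) U - 1‖ ≤ r} ≤ 32 / 3 * r ^ 6 := by
  have hη0 : 0 < r ^ 2 / 2 := by positivity
  have hsub : {U : Matrix.specialUnitaryGroup (Fin 3) ℂ | ‖fundamentalRep (Fin 3) U - 1‖ ≤ r} ⊆
      {U : Matrix.specialUnitaryGroup (Fin 3) ℂ |
        3 - ((U : Matrix (Fin 3) (Fin 3) ℂ).trace).re ≤ r ^ 2 / 2} := by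
    intro U hU
    have hU' : ‖fundamentalRep (Fin 3) U - 1‖ ≤ r := hU
    have hid := sub_re_trace_eq_half_norm_sub_one_sq (fundamentalRep_mem_unitaryGroup U)
    rw [fundamentalRep_apply] at hid hU'
    have hsq : ‖(U : Matrix (Fin 3) (Fin 3) ℂ) - 1‖ ^ 2 ≤ r ^ 2 := pow_le_pow_left₀ (norm_nonneg _) hU' 2
    show (3 : ℝ) - ((U : Matrix (Fin 3) (Fin 3) ℂ).trace).re ≤ r ^ 2 / 2
    have h3 : ((3 : ℕ) : ℝ) = 3 := by norm_num
    rw [h3] at hid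
    linarith
  have h := haar_su3_three_sub_trace_le_le hη0
  have e : (256 : ℝ) / 3 * (r ^ 2 / 2) ^ 3 = 32 / 3 * r ^ 6 := by ring
  rw [← e]
  exact (measureReal_mono hsub).trans h

end Summit.Ventures.LatticeQCDFlow.Theory2.WeakCoupling

end
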